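/-
Copyright (c) 2026 the pub-hodgecm-mathlib formalisation cell (harness21).  Prover seat hodgecm-mathlib-K2E3-p16 (g0), 2026-09-03.  Track B «K2-LIT», engine E3
«EllipticInputs», SIGS-TABLE-K2E3 row #16 (U5-d) — PROP. 12.6.1 (b) UNGATED FROM {stub 2, stub 4, THE WILD-ENGINE SOCKET 16W} (K2E3-plan (g1) DEALS BATCH #1, 22:03Z).
-/
import Summits.HodgeConjecture.HodgeConjecture.Theorems.F0P3cStCharTSDatumJunction17   -- ★ JUNCTION v17 (LH6-p01): (X3′) «(b)-REST NOT-WILD» + its §1 Jacquet-line lemma, (X0′-NW) socket, «HC-SC» (N0), `F0P3cStCharTSScFin`, PS-VANISH, LDS-FIELDS, RED-JH, WIF-AT-THE-DATUM, JAC-ELL C8, CARTAN-REPS∕FIELDS∕NULL, L2D-ELL, L2D-OF-HCB, DG-FIELD, ★ D2′, ★ 79 (SEP), ★ HOM-ZERO, the named fact `normalizedCharacter_locallyBounded`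
import Summits.HodgeConjecture.HodgeConjecture.Theorems.F0P3cStCharTSRung0TwentyTwo     -- ★ RUNG 0 v22 (import cone): ★ KEYS3-ANALYTIC, ★ LDS-RED-TWO, ★ LDS-TWO-OF-TWO, ★ `isQuadraticCharExtension_semilocalComponent_of_baseChange_eq`
import HarnessLib

/-!
# K2-LIT · E3 «EllipticInputs» · U5-d — `K2E3EllipticInnerNonzeroIsPairOfCrossWild`: PROP. 12.6.1 (b) at the pinned datum, UNGATED, from stub 2, stub 4 and the
# WILD-ENGINE SOCKET `sig_K2E3InnerGCharCrossEqZeroWild` (the cross-trace-zero at a wild place) — the place-free (X3′) head + the socket-#16 assembly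

Cell `pub/hodgecm-mathlib`, crux H413 = `stmt-HodgeConjecture-24833` (lane `--supports … --as helper`: THEOREMS ONLY — no definition ∕ instance ∕ notation ∕ axiom ∕ `sorry`;
count-neutral).  Namespace `Summit.HodgeConjecture.HodgeConjecture.Cruxes.H413.K2E3EllipticInnerNonzeroIsPairOfCrossWild`.  Socket: SIGS-TABLE-K2E3 row #16 =
`Cruxes/H413/Lines/K2_E3_EllipticInputsSigs_U5Kazhdan.lean` (87d8b4c974a167d7) :161–260 `U5Kazhdan.sig_K2E3EllipticInnerNonzeroIsPair`.  Sequel of ★ p855044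
`K2E3EllipticInnerNonzeroIsPair.ellipticInnerNonzeroIsPair_of_inputs (hHCB) (hKeysRed) (hWild)`: the unnamed WILD KERNEL `hWild` (stub 5 consequent 3) is REPLACED by the
ENGINE-CURRENCY socket 16W = `U5Kazhdan.sig_K2E3InnerGCharCrossEqZeroWild` (K2E3-plan (g1) DEALS BATCH #1 22:03Z «ONE shared WILD-ENGINE socket for 15W ∕ 16W ∕ 18W»; cand bytes
`K2/K2E3-p16/g0/sig_K2E3WildEllipticKernel.cand.K2E3-p16-g0.lean` 82ee481863d71ae1 = ★ (X0′-NW) `innerG_char_cross_eq_zero_of_not_wild` with `hv ↦ hw : ¬ (v unr ∨ |2|_v = 1)`).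

* §1 **`isEllipticPair_of_innerG_ne_zero_of_cross`** — the PLACE-FREE (X3′) head: ★ `F0P3cStCharTSP1261bRestNotWild.isEllipticPair_of_innerG_ne_zero_of_not_wild`'s statement and
  proof VERBATIM with the place token, measures, pins and ★ PCT-OUT letters (used there ONLY to call the (X0′-NW) socket) replaced by ONE hypothesis `hX0` = the socket's
  CONCLUSION at the datum; at a NOT-WILD place `hX0 :=` ★ the socket, at a WILD place `hX0 :=` the sig 16W.
* §2 **`ellipticInnerNonzeroIsPair_of_crossWild (hHCB) (hKeysRed) (hCrossW) : ‹socket #16›`** — conclusion = the socket's bytes TOKEN FOR TOKEN (`Pl`∕`HLoc` unfolded as in ★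
  JUNCTION v17), hypotheses CLOSED and BEFORE the frame: `hHCB` = stub 2, `hKeysRed` = stub 4 (type verbatim), `hCrossW` = 16W (type verbatim).  Proof = ★ p855044's (= ★ JUNCTION
  v17 :239–:356): letters `hWIF hC1–3 hL2 hLdsTwo hRedJH` from the 54 pins, then `π′` sc ⇒ ★ (N0); `π` sc ⇒ ★ (N0) + ★ `innerG_conj_symm`; else §1 with `hX0 :=` ★ (X0′-NW) at a
  not-wild place, `hX0 := hCrossW …` at a wild place.
RE-TIE FOR U5Kazhdan ED. 2 (planner's pen): `sig_K2E3EllipticInnerNonzeroIsPair := ellipticInnerNonzeroIsPair_of_crossWild (charLocBdd_of_sigs …) (keysReducibleList_of_sigs …) sig_K2E3InnerGCharCrossEqZeroWild`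
(DERIVED); #16's live residue is then EXACTLY the engine socket 16W (census `K2/K2E3-p16/g0/WILD-KERNEL-CENSUS.K2E3-p16-g0.md`).
HONEST LABEL: count-neutral helper; socket #16 OPEN until ED. 2 re-ties it DERIVED and 16W is paid; h413 OPEN; HC_CM is proved only modulo the 7 printed citations (2 remaining
named inputs hLiu418 = `stmt-HodgeConjecture-24832`, h413 = `stmt-HodgeConjecture-24833`) until rung 0 closes; nothing printed is asserted here.

## References
* [Rogawski1990] J. D. Rogawski, *Automorphic Representations of Unitary Groups in Three Variables*, Ann. of Math. Stud. 123 (1990): §12.2 pp. 172–174; §12.6 p. 187,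
  Prop. 12.6.1 (b) p. 188, proof p. 189 («Applying [K], Theorem F … and (b) follows»).
* [Kazhdan1986CuspidalGeometry] D. Kazhdan, *Cuspidal geometry of p-adic groups*, J. Analyse Math. 47 (1986) 1–36, Thm. F (NOT HELD; WANT acq-15177).
* [SchneiderStuhler1997] P. Schneider, U. Stuhler, *Representation theory and sheaves on the Bruhat–Tits building*, Publ. Math. IHÉS 85 (1997), §III.4 Thm. III.4.16.
* [Keys1984] D. Keys, Compositio Math. 51 (1984), §7 Thm.; [Casselman1995] §6.3, §7.1; [HarishChandra1999AdmissibleDistributions] Part III Thm. 16.3.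
-/

set_option autoImplicit false
-- the mandated namespace has the single-problem summit's repeated segment (`HodgeConjecture.HodgeConjecture`)
set_option linter.dupNamespace false

noncomputable section

open NumberField IsDedekindDomain MeasureTheory Filter Topology
open scoped Matrix MatrixGroups NNReal ENNReal
open Literature.MeasureTheory.Group
open Literature.NumberTheory.Rogawski1990 Literature.NumberTheory.Rogawski1990.Ch12Sec5
open Literature.NumberTheory.Automorphic Literature.NumberTheory.Automorphic.UnitaryGroup
open Literature.NumberTheory.Automorphic.UnitaryGroup.CotangentForms Literature.NumberTheory.GaloisRepresentations
open Literature.NumberTheory.Automorphic.Arthur2013.Leaves.TECR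

namespace Summit.HodgeConjecture.HodgeConjecture.Cruxes.H413.K2E3EllipticInnerNonzeroIsPairOfCrossWild

open Summit.HodgeConjecture.HodgeConjecture.Cruxes.H413 Summit.HodgeConjecture.HodgeConjecture.Cruxes.H413.F0P3cStCharTSTorusDefs

variable (L : Type) [Field L] [NumberField L] [IsCMField L] (v : HeightOneSpectrum (𝓞 ↥(maximalRealSubfield L)))

/-! ## §1 The PLACE-FREE (X3′) head: Prop. 12.6.1 (b) for elliptic non-supercuspidal pairs from the cross-trace-zero statement `hX0` at the datum -/
set_option maxHeartbeats 8000000 in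
set_option synthInstance.maxHeartbeats 400000 in
-- budget: three `IsConstituentOf (cmPrincipalSeries …)` shapes of `hRedJH` + the `SmoothInd` carrier of `cmPrincipalSeries` (class of ★ (X3′) :142, measured there at 8M)
/-- **PROP. 12.6.1 (b) FOR EVERY PAIR OF ELLIPTIC NON-SUPERCUSPIDAL CLASSES, PLACE-FREE, FROM THE CROSS-TRACE-ZERO STATEMENT.**  ★ (X3′)
`F0P3cStCharTSP1261bRestNotWild.isEllipticPair_of_innerG_ne_zero_of_not_wild` with its place token, measures, pins and ★ PCT-OUT letters (used there only to call the
(X0′-NW) socket) replaced by the hypothesis `hX0` — the socket's conclusion at the datum: for irreducible smooth `r, r′` of `U(Φ₃)(L⁺_v)` such that every smooth extension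
`0 → r′ → E → r → 0` splits and `Hom_G(r, r′) = 0`, `⟨χ_⟦r′⟧, χ_⟦r⟧⟩_e = 0`.  The other letters are ★ ELL-CLASS's VERBATIM (`hVan`, `hLds2`, `hRedJH`).  At a not-wild `v`
feed `hX0 :=` ★ `innerG_char_cross_eq_zero_of_not_wild …`; at a wild `v` feed the engine socket `sig_K2E3InnerGCharCrossEqZeroWild …`.  Proof: ★ (X3′)'s, token for token (★ D2′, `hVan`, ★ (X3′) §1 Jacquet line BY NAME, ★ 79 (SEP), ★ HOM-ZERO, `hX0`, ★ `innerG_ne_zero_comm`, `hRedJH`).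
[cite: Rogawski1990, §12.6 Prop. 12.6.1 (b) p. 188; §12.2 pp. 172–174] [cite: Casselman1995, §6.3, §7.1] [cite: Kazhdan1986CuspidalGeometry, Thm. F] -/
theorem isEllipticPair_of_innerG_ne_zero_of_cross
    (hns : ∀ w : PlacesOver L v, IsCMField.complexConj L • w.1 = w.1)
    [MeasurableSpace (Gqs L v)]
    [∀ γ : Gqs L v, MeasurableSpace (Gqs L v ⧸ Subgroup.centralizer ({γ} : Set (Gqs L v)))]
    [MeasurableSpace (Gqs L v ⧸ Subgroup.center (Gqs L v))]
    {H : Type} [Group H] [TopologicalSpace H] [IsTopologicalGroup H] [MeasurableSpace H]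
    (𝔇 : EllipticData (Gqs L v) H)
    -- (X0′) AT THE DATUM: the cross-trace-zero statement (★ socket at a not-wild place ∕ engine socket 16W at a wild place)
    (hX0 : ∀ (r r' : SmoothIrrep (Gqs L v)),
      (∀ (E : Type) [AddCommGroup E] [Module ℂ E] (ρE : Representation ℂ (Gqs L v) E), ρE.IsSmooth →
        ∀ (i : r'.ρ.IntertwiningMap ρE) (p : ρE.IntertwiningMap r.ρ), Function.Injective i → LinearMap.ker p.toLinearMap = LinearMap.range i.toLinearMap →
          Function.Surjective p → ∃ s : r.ρ.IntertwiningMap ρE, p.comp s = Representation.IntertwiningMap.id r.ρ) →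
      Subsingleton (r.ρ.IntertwiningMap r'.ρ) → 𝔇.innerG (𝔇.char (IrrClass.mk r')) (𝔇.char (IrrClass.mk r)) = 0)
    -- ★ ELL-CLASS's inputs VERBATIM (`hRedJH` = ★ RED-JH's conclusion)
    (hVan : ∀ (π : IrrClass (Gqs L v)) (χ₁ : (UnitaryGroup.LocalRing L v)ˣ →* ℂˣ) (χ₂ : ↥(normOneUnits (conjLocal L (IsCMField.complexConj L) v)) →* ℂˣ),
      Continuous (fun x => ((χ₁ x : ℂˣ) : ℂ)) → Continuous (fun x => ((χ₂ x : ℂˣ) : ℂ)) →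
      (UnitaryGroup.cmPrincipalSeries L 3 v (UnitaryGroup.cmTorusCharPair L v χ₁ χ₂)).IsIrreducible →
      π.IsConstituentOf (UnitaryGroup.cmPrincipalSeries L 3 v (UnitaryGroup.cmTorusCharPair L v χ₁ χ₂)) →
      ∀ γ ∈ 𝔇.ellG, 𝔇.char π γ = 0)
    (hLds2 : 𝔇.LdsCardTwo)
    (hRedJH : ∀ (χ₁ : (UnitaryGroup.LocalRing L v)ˣ →* ℂˣ) (χ₂ : ↥(normOneUnits (conjLocal L (IsCMField.complexConj L) v)) →* ℂˣ),
      Continuous (fun x => ((χ₁ x : ℂˣ) : ℂ)) → Continuous (fun x => ((χ₂ x : ℂˣ) : ℂ)) →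
      ¬ (UnitaryGroup.cmPrincipalSeries L 3 v (UnitaryGroup.cmTorusCharPair L v χ₁ χ₂)).IsIrreducible →
      (∃ P ∈ 𝔇.ldsPackets, ∀ c : IrrClass (Gqs L v),
          c.IsConstituentOf (UnitaryGroup.cmPrincipalSeries L 3 v (UnitaryGroup.cmTorusCharPair L v χ₁ χ₂)) ↔ c ∈ P) ∨
      (∃ ψ : ↥(Subgroup.center (Gqs L v)) →* ℂˣ, Continuous ψ ∧ ∀ c : IrrClass (Gqs L v),
          c.IsConstituentOf (UnitaryGroup.cmPrincipalSeries L 3 v (UnitaryGroup.cmTorusCharPair L v χ₁ χ₂)) ↔ (c = 𝔇.stG ψ ∨ c = 𝔇.detG ψ)) ∨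
      (∃ ξ' : H →* ℂˣ, Continuous ξ' ∧ ∀ c : IrrClass (Gqs L v),
          c.IsConstituentOf (UnitaryGroup.cmPrincipalSeries L 3 v (UnitaryGroup.cmTorusCharPair L v χ₁ χ₂)) ↔ (c = 𝔇.pi2 ξ' ∨ c = 𝔇.piN ξ'))) :
    ∀ π π' : IrrClass (Gqs L v), 𝔇.IsEllipticRep π → 𝔇.IsEllipticRep π' → ¬ π.IsSupercuspidal → ¬ π'.IsSupercuspidal →
      𝔇.innerG (𝔇.char π) (𝔇.char π') ≠ 0 → π ≠ π' → 𝔇.IsEllipticPair π π' := by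
  haveI := locallyCompactSpace_cmBorelU L 3 v
  intro π π' hπ hπ' hsc hsc' hinner hne
  -- (0) realise both classes inside principal series (★ D2′; the supercuspidal branch is excluded)
  obtain ⟨r, hr, χ₁, χ₂, h1c, h2c, φ, hφ⟩ : ∃ r : SmoothIrrep (Gqs L v), IrrClass.mk r = π ∧
      ∃ (χ₁ : (LocalRing L v)ˣ →* ℂˣ) (χ₂ : ↥(normOneUnits (conjLocal L (IsCMField.complexConj L) v)) →* ℂˣ),
        Continuous (fun x => ((χ₁ x : ℂˣ) : ℂ)) ∧ Continuous (fun x => ((χ₂ x : ℂˣ) : ℂ)) ∧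
        ∃ f : r.ρ.IntertwiningMap (cmPrincipalSeries L 3 v (cmTorusCharPair L v χ₁ χ₂)), Function.Injective f :=
    (F0P3JacquetEmbeddingDichotomy.isSupercuspidal_or_exists_injective_intertwiningMap_cmPrincipalSeries_of_irrClass L v hns π).resolve_left hsc
  obtain ⟨r', hr', χ₁', χ₂', h1c', h2c', φ', hφ'⟩ : ∃ r' : SmoothIrrep (Gqs L v), IrrClass.mk r' = π' ∧
      ∃ (χ₁' : (LocalRing L v)ˣ →* ℂˣ) (χ₂' : ↥(normOneUnits (conjLocal L (IsCMField.complexConj L) v)) →* ℂˣ),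
        Continuous (fun x => ((χ₁' x : ℂˣ) : ℂ)) ∧ Continuous (fun x => ((χ₂' x : ℂˣ) : ℂ)) ∧
        ∃ f : r'.ρ.IntertwiningMap (cmPrincipalSeries L 3 v (cmTorusCharPair L v χ₁' χ₂')), Function.Injective f :=
    (F0P3JacquetEmbeddingDichotomy.isSupercuspidal_or_exists_injective_intertwiningMap_cmPrincipalSeries_of_irrClass L v hns π').resolve_left hsc'
  -- both series are REDUCIBLE (their constituents `π`, `π′` are elliptic: ★ `hVan`)
  have hπ'c : π'.IsConstituentOf (cmPrincipalSeries L 3 v (cmTorusCharPair L v χ₁' χ₂')) := by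
    rw [← hr']; exact (IrrClass.isConstituentOf_mk_self r').of_injective φ' hφ'
  have hπc : π.IsConstituentOf (cmPrincipalSeries L 3 v (cmTorusCharPair L v χ₁ χ₂)) := by
    rw [← hr]; exact (IrrClass.isConstituentOf_mk_self r).of_injective φ hφ
  have hI'red : ¬ (cmPrincipalSeries L 3 v (cmTorusCharPair L v χ₁' χ₂')).IsIrreducible := by
    intro hirr
    obtain ⟨γ, hγ, hne0⟩ := hπ'
    exact hne0 (hVan π' χ₁' χ₂' h1c' h2c' hirr hπ'c γ hγ)
  have hIred : ¬ (cmPrincipalSeries L 3 v (cmTorusCharPair L v χ₁ χ₂)).IsIrreducible := by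
    intro hirr
    obtain ⟨γ, hγ, hne0⟩ := hπ
    exact hne0 (hVan π χ₁ χ₂ h1c h2c hirr hπc γ hγ)
  -- (1) THE CLAIM: `π` is a constituent of `I′ = i_G(χ′)` — by block separation + the cross-trace socket
  have hA : π.IsConstituentOf (cmPrincipalSeries L 3 v (cmTorusCharPair L v χ₁' χ₂')) := by
    by_contra hB
    -- the two inducing characters differ (else `I = I′` and `π ∈ JH(I′)` via `φ`)
    have hneχ : cmTorusCharPair L v χ₁' χ₂' ≠ cmTorusCharPair L v χ₁ χ₂ := by
      intro heq
      apply hB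
      rw [heq]
      exact hπc
    -- the Jacquet line of `r` (§1): `T` acts on `r_B(r)` by `χ`
    have hθ := F0P3cStCharTSP1261bRestNotWild.normalizedJacquet_eq_smul_of_injective_of_not_isIrreducible L v hns χ₁ χ₂ h1c h2c r φ hφ hIred
    -- every smooth extension `0 → r′ → E → r → 0` SPLITS (★ 79 (SEP); the other alternative embeds `E` in `I′` and puts `π` in `JH(I′)`)
    have hsplit₂ : ∀ (E : Type) [AddCommGroup E] [Module ℂ E] (ρE : Representation ℂ (Gqs L v) E), ρE.IsSmooth →
        ∀ (i : r'.ρ.IntertwiningMap ρE) (p : ρE.IntertwiningMap r.ρ), Function.Injective i → LinearMap.ker p.toLinearMap = LinearMap.range i.toLinearMap →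
          Function.Surjective p → ∃ s : r.ρ.IntertwiningMap ρE, p.comp s = Representation.IntertwiningMap.id r.ρ := by
      intro E _ _ ρE hE i p hi hker hp
      have hVirr : ∀ S : Submodule ℂ r.V, (∀ g, S ≤ S.comap (r.ρ g)) → S = ⊥ ∨ S = ⊤ := by
        intro S hS
        haveI : IsSimpleOrder (Subrepresentation r.ρ) := r.isIrreducible
        rcases IsSimpleOrder.eq_bot_or_eq_top (⟨S, fun g _ hx => hS g hx⟩ : Subrepresentation r.ρ) with h | h
        · exact Or.inl (congrArg Subrepresentation.toSubmodule h)
        · exact Or.inr (congrArg Subrepresentation.toSubmodule h)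
      let σ' : Representation ℂ ↥(cmBorelTriple L 3 v).M ℂ :=
        (Representation.trivial ℂ ↥(torusU (conjLocal L (IsCMField.complexConj L) v) (cmLocalForm L 3 v)) ℂ).twist (cmTorusCharPair L v χ₁' χ₂')
      have hσ' : ∀ (m : ↥(cmBorelTriple L 3 v).M) (y : ℂ), σ' m y = ((cmTorusCharPair L v χ₁' χ₂' m : ℂˣ) : ℂ) • y := fun m y => by
        simp only [σ', Representation.twist_apply, Representation.trivial_apply]
      let ι : r'.ρ.IntertwiningMap (Representation.normalizedInd (cmBorelTriple L 3 v) σ') := φ'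
      have hι : Function.Injective ι := hφ'
      rcases Representation.exists_section_or_exists_injective_of_isotypic_normalizedJacquet (cmBorelTriple L 3 v)
          (isLimitOfCompactOpen_cmBorelTriple_N L 3 v) (deltaChar_cmBorelTriple_eq_one_of_mem_N L 3 v)
          (fun m m' => torusU_mul_comm _ _ m m') r'.isSmooth hE i p hi hker hp hVirr
          (cmTorusCharPair L v χ₁ χ₂) hθ σ' (cmTorusCharPair L v χ₁' χ₂') hσ' hneχ ι hι with hs | ⟨Φ, hΦ, -⟩
      · exact hs
      · exact absurd (((IrrClass.isConstituentOf_mk_self r).of_surjective p hp).of_injective Φ hΦ) (by rw [hr]; exact hB)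
    -- Schur for the distinct classes, then the socket contradicts `⟨χ_π, χ_π′⟩ ≠ 0`
    have hHom0 : Subsingleton (r.ρ.IntertwiningMap r'.ρ) :=
      SmoothIrrep.subsingleton_intertwiningMap_of_mk_ne_mk r r' (by rw [hr, hr']; exact hne)
    have h0 := hX0 r r' hsplit₂ hHom0
    rw [hr, hr'] at h0
    exact F0P3cStCharTSP1261bOfCases.innerG_ne_zero_comm 𝔇 hinner h0
  -- (2) `π, π′ ∈ JH(I′)`, `I′` reducible: Rogawski's list names the pair
  rcases hRedJH χ₁' χ₂' h1c' h2c' hI'red with ⟨P, hP, hmem⟩ | ⟨ψ, hψc, hmem⟩ | ⟨ξ', hξc, hmem⟩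
  · -- an l.d.s. packet `P ∋ π, π′`; `P` has exactly two members (★ `LdsCardTwo`)
    refine Or.inl ⟨P, hP, fun σ => ⟨fun hσ => ?_, fun hσ => ?_⟩⟩
    · obtain ⟨τ, hτP, hτne, hall⟩ := hLds2 P hP π ((hmem π).1 hA)
      rcases hall σ hσ with h | h
      · exact Or.inl h
      · rcases hall π' ((hmem π').1 hπ'c) with h' | h'
        · exact absurd h'.symm hne
        · exact Or.inr (h.trans h'.symm)
    · rcases hσ with rfl | rfl
      · exact (hmem _).1 hA
      · exact (hmem _).1 hπ'c
  · -- the EP family `{St_G ψ, ψ∘det_G}`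
    refine Or.inr (Or.inl ⟨ψ, hψc, ?_⟩)
    rcases (hmem π).1 hA with h1 | h1 <;> rcases (hmem π').1 hπ'c with h2 | h2
    · exact absurd (h1.trans h2.symm) hne
    · exact Or.inl ⟨h1, h2⟩
    · exact Or.inr ⟨h1, h2⟩
    · exact absurd (h1.trans h2.symm) hne
  · -- Keys' family `{π²(ξ′), πⁿ(ξ′)}`
    refine Or.inr (Or.inr ⟨ξ', hξc, ?_⟩)
    rcases (hmem π).1 hA with h1 | h1 <;> rcases (hmem π').1 hπ'c with h2 | h2
    · exact absurd (h1.trans h2.symm) hne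
    · exact Or.inl ⟨h1, h2⟩
    · exact Or.inr ⟨h1, h2⟩
    · exact absurd (h1.trans h2.symm) hne


/-! ## §2 Socket #16 from stub 2, stub 4 and the WILD-ENGINE socket 16W -/

set_option maxHeartbeats 16000000 in
set_option synthInstance.maxHeartbeats 400000 in
-- budget: two organ-size frames (the socket's 66 binders ∕ 54 pins + the 16W letters) + ★ RED-JH's three `IsConstituentOf (cmPrincipalSeries …)` shapes (class of ★ JUNCTION v17 ∕ ★ p855044, 16M)
open Pointwise in
open scoped Classical in
/-- **PROP. 12.6.1 (b) AT THE PINNED DATUM, UNGATED (= socket `sig_K2E3EllipticInnerNonzeroIsPair`, SIGS-TABLE-K2E3 row #16) FROM stub 2, stub 4 AND THE WILD-ENGINE SOCKET 16W.**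
Conclusion = the socket's statement TOKEN FOR TOKEN; hypotheses closed, before the frame: `hHCB` = stub 2, `hKeysRed` = stub 4 (type verbatim), `hCrossW` = 16W
`U5Kazhdan.sig_K2E3InnerGCharCrossEqZeroWild` (type verbatim).  Proof = ★ p855044's (letters from the 54 pins; ★ (N0) for supercuspidal members; else §1 with `hX0 :=` ★ (X0′-NW)
at a not-wild place, `hX0 := hCrossW …` at a wild place).
[cite: Rogawski1990, §12.6 Prop. 12.6.1 (b) p. 188, proof p. 189; §12.2 pp. 173–174] [cite: Kazhdan1986CuspidalGeometry, Thm. F] [cite: Keys1984, §7 Thm.]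
[cite: HarishChandra1999AdmissibleDistributions, Part III Thm. 16.3] [cite: SchneiderStuhler1997, §III.4 Thm. III.4.16] -/
theorem ellipticInnerNonzeroIsPair_of_crossWild
    -- INPUT 1 = tier-0 stub 2 `stub_charLocBdd` BY NAME (★ named fact [HarishChandra1999AdmissibleDistributions III Thm. 16.3]; U12)
    (hHCB : normalizedCharacter_locallyBounded)
    -- INPUT 2 = tier-0 stub 4 `stub_keysReducibleList` BY NAME (type VERBATIM, `Pl` unfolded; U4) [cite: Keys1984, §7 Thm.] [cite: Rogawski1990, §12.2 p. 173]
    (hKeysRed :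
      ∀ (L : Type) [Field L] [NumberField L] [IsCMField L] (v : HeightOneSpectrum (𝓞 ↥(maximalRealSubfield L))),
      (∀ w : PlacesOver L v, IsCMField.complexConj L • w.1 = w.1) →
      (∀ (χ₁ : (UnitaryGroup.LocalRing L v)ˣ →* ℂˣ) (χ₂ : ↥(normOneUnits (conjLocal L (IsCMField.complexConj L) v)) →* ℂˣ), Continuous (fun x => ((χ₁ x : ℂˣ) : ℂ)) → Continuous (fun x => ((χ₂ x : ℂˣ) : ℂ)) → (∃ N : Subrepresentation (UnitaryGroup.cmPrincipalSeries L 3 v (UnitaryGroup.cmTorusCharPair L v χ₁ χ₂)), N ≠ ⊥ ∧ N ≠ ⊤) → (χ₁ = halfModulusChar (UnitaryGroup.LocalRing L v) * halfModulusChar (UnitaryGroup.LocalRing L v) ∨ χ₁ = (halfModulusChar (UnitaryGroup.LocalRing L v) * halfModulusChar (UnitaryGroup.LocalRing L v))⁻¹) ∨ (∃ η : (UnitaryGroup.LocalRing L v)ˣ →* ℂˣ, IsQuadraticCharExtension (conjLocal L (IsCMField.complexConj L) v) η ∧ Continuous (fun x => ((η x : ℂˣ) : ℂ)) ∧ (χ₁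 = η * halfModulusChar (UnitaryGroup.LocalRing L v) ∨ χ₁ = η * (halfModulusChar (UnitaryGroup.LocalRing L v))⁻¹)) ∨ (χ₁ ≠ 1 ∧ ∀ a : (UnitaryGroup.LocalRing L v)ˣ, (conjLocal L (IsCMField.complexConj L) v) (a : UnitaryGroup.LocalRing L v) = a → χ₁ a = 1)))
    -- INPUT 3 = the WILD-ENGINE socket `U5Kazhdan.sig_K2E3InnerGCharCrossEqZeroWild` (cand 82ee481863d71ae1, K2E3-plan (g1) DEAL 22:03Z) BY NAME: its type VERBATIM, `Pl` unfolded [cite: Rogawski1990, §12.6 p. 187] [cite: SchneiderStuhler1997, §III.4 Thm. III.4.16]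
    (hCrossW :
      ∀ (L : Type) [Field L] [NumberField L] [IsCMField L] (v : HeightOneSpectrum (𝓞 ↥(maximalRealSubfield L)))
      (hns : ∀ w : PlacesOver L v, IsCMField.complexConj L • w.1 = w.1) (hw : ¬ (Algebra.IsUnramifiedIn (𝓞 L) v.asIdeal ∨ Valued.v (2 : v.adicCompletion ↥(maximalRealSubfield L)) = 1))
      [MeasurableSpace (Gqs L v)] [BorelSpace (Gqs L v)]
      [∀ γ : Gqs L v, MeasurableSpace (Gqs L v ⧸ Subgroup.centralizer ({γ} : Set (Gqs L v)))] [∀ γ : Gqs L v, BorelSpace (Gqs L v ⧸ Subgroup.centralizer ({γ} : Set (Gqs L v)))]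
      [MeasurableSpace (Gqs L v ⧸ Subgroup.center (Gqs L v))]
      {H : Type} [Group H] [TopologicalSpace H] [IsTopologicalGroup H] [MeasurableSpace H]
      (νQv : Measure (Gqs L v)) [νQv.IsHaarMeasure] [νQv.IsMulRightInvariant] (mQv : OrbitalMeasureFamily (Gqs L v))
      (hcanQ : mQv.IsCanonical (fun γ => IsRegularElt (γ.val : GL (Fin 3) (UnitaryGroup.LocalRing L v))) νQv)
      (𝔇 : EllipticData (Gqs L v) H) (hμG : 𝔇.μG = νQv) (horb : 𝔇.orb = mQv)
      (hreg : ∀ γ : Gqs L v, γ ∈ 𝔇.regG ↔ IsRegularElt (γ.val : GL (Fin 3) (UnitaryGroup.LocalRing L v)))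
      (hE : ∀ γ : Gqs L v, γ ∈ 𝔇.ellG ↔ IsRegularElt (γ.val : GL (Fin 3) (UnitaryGroup.LocalRing L v)) ∧ γ ∉ hyperbolicSet L v)
      (hM1 : ∀ π : IrrClass (Gqs L v), Measurable (𝔇.char π) ∧ LocallyIntegrable (𝔇.char π) 𝔇.μG ∧ (∀ x ∈ 𝔇.regG, ∀ᶠ y in 𝓝 x, 𝔇.char π y = 𝔇.char π x) ∧
      ∀ φ : Gqs L v → ℂ, IsLocSmooth φ → π.smoothTrace 𝔇.μG φ = ∫ x, φ x * 𝔇.char π x ∂𝔇.μG)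
      (hWIF : 𝔇.WeylIntegrationFormula) (hC1 : 𝔇.EllCartanSubset) (hC2 : 𝔇.EllCartanAE) (hC3 : 𝔇.NonEllCartanAE) (hL2 : 𝔇.L2CharOnTorusAll)   -- ★ PCT-OUT's extra letters
      (r : SmoothIrrep (Gqs L v))
      -- the CROSS letters: a second irreducible smooth `r′`; every SMOOTH extension of `r.ρ` BY `r′.ρ` splits (★ (J′)'s text at `V := r.ρ`, `W := r′.ρ`); `Hom_G(r, r′) = 0`
      (r' : SmoothIrrep (Gqs L v))
      (hsplit₂ : ∀ (E : Type) [AddCommGroup E] [Module ℂ E] (ρE : Representation ℂ (Gqs L v) E), ρE.IsSmooth →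
      ∀ (i : r'.ρ.IntertwiningMap ρE) (p : ρE.IntertwiningMap r.ρ), Function.Injective i → LinearMap.ker p.toLinearMap = LinearMap.range i.toLinearMap →
      Function.Surjective p → ∃ s : r.ρ.IntertwiningMap ρE, p.comp s = Representation.IntertwiningMap.id r.ρ)
      (hHom0 : Subsingleton (r.ρ.IntertwiningMap r'.ρ)),
      𝔇.innerG (𝔇.char (IrrClass.mk r')) (𝔇.char (IrrClass.mk r)) = 0) :
  ∀ (L : Type) [Field L] [NumberField L] [IsCMField L] (μ : HeckeCharacter L) (ξ : OneDimAutRepH L) (v : HeightOneSpectrum (𝓞 ↥(maximalRealSubfield L))),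
    (∀ w : PlacesOver L v, IsCMField.complexConj L • w.1 = w.1) → μ.IsUnitary →
    (∀ x : Literature.NumberTheory.GaloisRepresentations.ideleGroup ↥(maximalRealSubfield L),
      μ (AdeleRing.ideleBaseChange (↥(maximalRealSubfield L)) L x) = quadraticHeckeCharCM L x) →
    ∀ [MeasurableSpace (((UnitaryGroup.cmDatum L 2 (Matrix.of fun i j : Fin 2 => if i.val + j.val + 1 = 2 then (1 : L) else 0)).Local v × (UnitaryGroup.cmDatum L 1 (Matrix.of fun i j : Fin 1 => if i.val + j.val + 1 = 1 then (1 : L) else 0)).Local v))] [BorelSpace (((UnitaryGroup.cmDatum L 2 (Matrix.of fun i j : Fin 2 => if i.val + j.val + 1 = 2 then (1 : L) else 0)).Local v × (UnitaryGroup.cmDatum L 1 (Matrix.of fun i j : Fin 1 => if i.val + j.val + 1 = 1 then (1 : L) else 0)).Local v))] [MeasurableSpace (Gqs L v)] [BorelSpace (Gqs L v)]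
      (νHv : Measure (((UnitaryGroup.cmDatum L 2 (Matrix.of fun i j : Fin 2 => if i.val + j.val + 1 = 2 then (1 : L) else 0)).Local v × (UnitaryGroup.cmDatum L 1 (Matrix.of fun i j : Fin 1 => if i.val + j.val + 1 = 1 then (1 : L) else 0)).Local v))) (νQv : Measure (Gqs L v))
      [νHv.IsHaarMeasure] [νHv.IsMulRightInvariant] [νQv.IsHaarMeasure] [νQv.IsMulRightInvariant],
    letI : ∀ a : ((UnitaryGroup.cmDatum L 2 (Matrix.of fun i j : Fin 2 => if i.val + j.val + 1 = 2 then (1 : L) else 0)).Local v × (UnitaryGroup.cmDatum L 1 (Matrix.of fun i j : Fin 1 => if i.val + j.val + 1 = 1 then (1 : L) else 0)).Local v), MeasurableSpace (((UnitaryGroup.cmDatum L 2 (Matrix.of fun i j : Fin 2 => if i.val + j.val + 1 = 2 then (1 : L) else 0)).Local v × (UnitaryGroup.cmDatum L 1 (Matrix.of fun i j : Fin 1 => if i.val + j.val + 1 = 1 then (1 : L) else 0)).Local v) ⧸ Subgroup.centralizer ({a} : Set (((UnitaryGroup.cmDatum L 2 (Matrix.of fun i j : Fin 2 => if i.val + j.val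 + 1 = 2 then (1 : L) else 0)).Local v × (UnitaryGroup.cmDatum L 1 (Matrix.of fun i j : Fin 1 => if i.val + j.val + 1 = 1 then (1 : L) else 0)).Local v)))) := fun _ => borel _
    haveI : ∀ a : ((UnitaryGroup.cmDatum L 2 (Matrix.of fun i j : Fin 2 => if i.val + j.val + 1 = 2 then (1 : L) else 0)).Local v × (UnitaryGroup.cmDatum L 1 (Matrix.of fun i j : Fin 1 => if i.val + j.val + 1 = 1 then (1 : L) else 0)).Local v), BorelSpace (((UnitaryGroup.cmDatum L 2 (Matrix.of fun i j : Fin 2 => if i.val + j.val + 1 = 2 then (1 : L) else 0)).Local v × (UnitaryGroup.cmDatum L 1 (Matrix.of fun i j : Fin 1 => if i.val + j.val + 1 = 1 then (1 : L) else 0)).Local v) ⧸ Subgroup.centralizer ({a} : Set (((UnitaryGroup.cmDatum L 2 (Matrix.of fun i j : Fin 2 => if i.val + j.val + 1 = 2 then (1 : L) else 0)).Local v × (UnitaryGroup.cmDatum L 1 (Matrix.of fun i j : Fin 1 => if i.val + j.val + 1 = 1 then (1 : L) else 0)).Local v)))) := fun _ => ⟨rfl⟩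
    letI : ∀ γ : Gqs L v, MeasurableSpace (Gqs L v ⧸ Subgroup.centralizer ({γ} : Set (Gqs L v))) := fun _ => borel _
    haveI : ∀ γ : Gqs L v, BorelSpace (Gqs L v ⧸ Subgroup.centralizer ({γ} : Set (Gqs L v))) := fun _ => ⟨rfl⟩
    ∀ (mHv : OrbitalMeasureFamily (((UnitaryGroup.cmDatum L 2 (Matrix.of fun i j : Fin 2 => if i.val + j.val + 1 = 2 then (1 : L) else 0)).Local v × (UnitaryGroup.cmDatum L 1 (Matrix.of fun i j : Fin 1 => if i.val + j.val + 1 = 1 then (1 : L) else 0)).Local v))) (mQv : OrbitalMeasureFamily (Gqs L v)),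
      mHv.IsCanonical (IsLocalGRegular L v) νHv →
      mQv.IsCanonical (fun γ => IsRegularElt (γ.val : GL (Fin 3) (UnitaryGroup.LocalRing L v))) νQv →
      IsLocalDeltaTransferExists L (qsForm L) v ((finExplicitCollection L (qsForm L) μ (finExplicitDelta_conj_left_all L (qsForm L) μ) (finExplicitDelta_conj_right_all L (qsForm L) μ)) v) mHv mQv IsLocSmooth IsLocSmooth →
      ∀ (π₁ πSt : IrrClass (((UnitaryGroup.cmDatum L 2 (Matrix.of fun i j : Fin 2 => if i.val + j.val + 1 = 2 then (1 : L) else 0)).Local v × (UnitaryGroup.cmDatum L 1 (Matrix.of fun i j : Fin 1 => if i.val + j.val + 1 = 1 then (1 : L) else 0)).Local v))),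
        HLengthTwoLabels L v
          (torusCharPair (conjLocal L (IsCMField.complexConj L) v) (cmLocalForm L 2 v) (cmLocalForm_eq_over L 2 v) 0
            ((torusLocalComponent L (IsCMField.complexConj L) v ξ.η).comp
                (quotConj (conjLocal L (IsCMField.complexConj L) v) (conjLocal_conjLocal_cm L v)) *
              halfModulusChar (UnitaryGroup.LocalRing L v))
            (torusLocalComponent L (IsCMField.complexConj L) v ξ.ψ))
          ((torusLocalComponent L (IsCMField.complexConj L) v ξ.ψ).comp (localDet (IsCMField.complexConj L) v (isUnit_antidiagOne_det L 1))) π₁ πSt →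
        (∀ fH : ((UnitaryGroup.cmDatum L 2 (Matrix.of fun i j : Fin 2 => if i.val + j.val + 1 = 2 then (1 : L) else 0)).Local v × (UnitaryGroup.cmDatum L 1 (Matrix.of fun i j : Fin 1 => if i.val + j.val + 1 = 1 then (1 : L) else 0)).Local v) → ℂ, IsLocSmooth fH → π₁.smoothTrace νHv fH = charDist (ξ.xiLocalChar v) νHv fH) →
      ∀ [MeasurableSpace (Gqs L v ⧸ Subgroup.center (Gqs L v))] [BorelSpace (Gqs L v ⧸ Subgroup.center (Gqs L v))]
        (μZ : Measure (Gqs L v ⧸ Subgroup.center (Gqs L v))) [μZ.IsHaarMeasure],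
      ∀ (Sell : Finset (Subgroup (Gqs L v))) (μTf : (T' : Subgroup (Gqs L v)) → Measure ↥T') (SH : Finset (Subgroup ((UnitaryGroup.cmDatum L 2 (Matrix.of fun i j : Fin 2 => if i.val + j.val + 1 = 2 then (1 : L) else 0)).Local v × (UnitaryGroup.cmDatum L 1 (Matrix.of fun i j : Fin 1 => if i.val + j.val + 1 = 1 then (1 : L) else 0)).Local v))) (μTHf : (T' : Subgroup ((UnitaryGroup.cmDatum L 2 (Matrix.of fun i j : Fin 2 => if i.val + j.val + 1 = 2 then (1 : L) else 0)).Local v × (UnitaryGroup.cmDatum L 1 (Matrix.of fun i j : Fin 1 => if i.val + j.val + 1 = 1 then (1 : L) else 0)).Local v)) → Measure ↥T'),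
        (∀ T ∈ Sell, IsCompact (T : Set (Gqs L v)) ∧ ∃ γ₀ : Gqs L v, IsRegularElt (γ₀.val : GL (Fin 3) (UnitaryGroup.LocalRing L v)) ∧ T = Subgroup.centralizer ({γ₀} : Set (Gqs L v))) →  -- hcartO
        (∀ γ : (Gqs L v), IsRegularElt (γ.val : GL (Fin 3) (UnitaryGroup.LocalRing L v)) → ∃ T' ∈ insert (cmBorelTriple L 3 v).M Sell, ∃ x : (Gqs L v), ∀ g : (Gqs L v), g ∈ Subgroup.centralizer ({γ} : Set (Gqs L v)) ↔ x⁻¹ * g * x ∈ T') →  -- hcovGO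
        (∀ T' ∈ insert (cmBorelTriple L 3 v).M Sell, ∀ T'' ∈ insert (cmBorelTriple L 3 v).M Sell, T' ≠ T'' → ∀ y : (Gqs L v), ¬ ∀ h : (Gqs L v), h ∈ T'' ↔ y⁻¹ * h * y ∈ T') →  -- hncGO
        (∀ T ∈ Sell, (μTf T).IsHaarMeasure) →  -- hHaarGO
        (∀ T' ∈ Sell, μTf T' (compactCore ↥T') = 1) →  -- hcoreGO
        (μTf (cmBorelTriple L 3 v).M).IsHaarMeasure →  -- hHaarMO
        (μTf (cmBorelTriple L 3 v).M (compactCore ↥(cmBorelTriple L 3 v).M) = 1) →  -- hcoreMO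
        (∀ T' ∈ SH, IsCompact (T' : Set ((UnitaryGroup.cmDatum L 2 (Matrix.of fun i j : Fin 2 => if i.val + j.val + 1 = 2 then (1 : L) else 0)).Local v × (UnitaryGroup.cmDatum L 1 (Matrix.of fun i j : Fin 1 => if i.val + j.val + 1 = 1 then (1 : L) else 0)).Local v)) ∧ ∃ γ₀ : ((UnitaryGroup.cmDatum L 2 (Matrix.of fun i j : Fin 2 => if i.val + j.val + 1 = 2 then (1 : L) else 0)).Local v × (UnitaryGroup.cmDatum L 1 (Matrix.of fun i j : Fin 1 => if i.val + j.val + 1 = 1 then (1 : L) else 0)).Local v), IsLocalGRegular L v γ₀ ∧ T' = Subgroup.centralizer ({γ₀} : Set ((UnitaryGroup.cmDatum L 2 (Matrix.of fun i j : Fin 2 => if i.val + j.val + 1 = 2 then (1 : L) else 0)).Local v × (UnitaryGroup.cmDatum L 1 (Matrix.of fun i j : Fin 1 => if i.val + j.val + 1 = 1 then (1 : L) else 0)).Local v))) →  -- hKHO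
        (∀ γ₀ : ((UnitaryGroup.cmDatum L 2 (Matrix.of fun i j : Fin 2 => if i.val + j.val + 1 = 2 then (1 : L) else 0)).Local v × (UnitaryGroup.cmDatum L 1 (Matrix.of fun i j : Fin 1 => if i.val + j.val + 1 = 1 then (1 : L) else 0)).Local v), IsLocalGRegular L v γ₀ → IsCompact ((Subgroup.centralizer ({γ₀} : Set ((UnitaryGroup.cmDatum L 2 (Matrix.of fun i j : Fin 2 => if i.val + j.val + 1 = 2 then (1 : L) else 0)).Local v × (UnitaryGroup.cmDatum L 1 (Matrix.of fun i j : Fin 1 => if i.val + j.val + 1 = 1 then (1 : L) else 0)).Local v)) : Subgroup ((UnitaryGroup.cmDatum L 2 (Matrix.of fun i j : Fin 2 => if i.val + j.val + 1 = 2 then (1 : L) else 0)).Local v × (UnitaryGroup.cmDatum L 1 (Matrix.of fun i j : Fin 1 => if i.val + j.val + 1 = 1 then (1 : L) else 0)).Local v)) : Set ((UnitaryGroup.cmDatum L 2 (Matrix.of fun i j : Fin 2 => if i.val + j.val + 1 = 2 then (1 : L) else 0)).Local v × (UnitaryGroup.cmDatum L 1 (Matrix.of fun i j : Fin 1 =>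 if i.val + j.val + 1 = 1 then (1 : L) else 0)).Local v)) → ∃ T' ∈ SH, ∃ x : ((UnitaryGroup.cmDatum L 2 (Matrix.of fun i j : Fin 2 => if i.val + j.val + 1 = 2 then (1 : L) else 0)).Local v × (UnitaryGroup.cmDatum L 1 (Matrix.of fun i j : Fin 1 => if i.val + j.val + 1 = 1 then (1 : L) else 0)).Local v), Subgroup.centralizer ({x * γ₀ * x⁻¹} : Set ((UnitaryGroup.cmDatum L 2 (Matrix.of fun i j : Fin 2 => if i.val + j.val + 1 = 2 then (1 : L) else 0)).Local v × (UnitaryGroup.cmDatum L 1 (Matrix.of fun i j : Fin 1 => if i.val + j.val + 1 = 1 then (1 : L) else 0)).Local v)) = T') →  -- hcovHO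
        (∀ T' ∈ SH, ∀ T'' ∈ SH, (∃ x : ((UnitaryGroup.cmDatum L 2 (Matrix.of fun i j : Fin 2 => if i.val + j.val + 1 = 2 then (1 : L) else 0)).Local v × (UnitaryGroup.cmDatum L 1 (Matrix.of fun i j : Fin 1 => if i.val + j.val + 1 = 1 then (1 : L) else 0)).Local v), T'.map (MulAut.conj x).toMonoidHom = T'') → T' = T'') →  -- hncHO
        (∀ T' ∈ SH, (μTHf T').IsHaarMeasure) →  -- hHaarHO
        (∀ T' ∈ SH, IsProbabilityMeasure (μTHf T')) →  -- hprobHO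
        ∀ (𝔇 : Ch12Sec5.EllipticData (Gqs L v) ((UnitaryGroup.cmDatum L 2 (Matrix.of fun i j : Fin 2 => if i.val + j.val + 1 = 2 then (1 : L) else 0)).Local v × (UnitaryGroup.cmDatum L 1 (Matrix.of fun i j : Fin 1 => if i.val + j.val + 1 = 1 then (1 : L) else 0)).Local v)) (par : (IrrClass (Gqs L v) → ((((UnitaryGroup.LocalRing L v)ˣ →* ℂˣ) × (↥(normOneUnits (conjLocal L (IsCMField.complexConj L) v)) →* ℂˣ))))),
          𝔇.μG = νQv →  -- hC01
          𝔇.μH = νHv →  -- hC02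
          𝔇.μGZ = μZ →  -- hC03
          𝔇.orb = mQv →  -- hC04
          (∀ γ : Gqs L v, γ ∈ 𝔇.regG ↔ IsRegularElt (γ.val : GL (Fin 3) (UnitaryGroup.LocalRing L v))) →  -- hC05
          (∀ (φ : Gqs L v → ℂ) (fH : ((UnitaryGroup.cmDatum L 2 (Matrix.of fun i j : Fin 2 => if i.val + j.val + 1 = 2 then (1 : L) else 0)).Local v × (UnitaryGroup.cmDatum L 1 (Matrix.of fun i j : Fin 1 => if i.val + j.val + 1 = 1 then (1 : L) else 0)).Local v) → ℂ), 𝔇.IsTransfer φ fH ↔ IsLocalDeltaTransfer L (qsForm L) v ((finExplicitCollection L (qsForm L) μ (finExplicitDelta_conj_left_all L (qsForm L) μ) (finExplicitDelta_conj_right_all L (qsForm L) μ)) v) mHv mQv fH φ) →  -- hC06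
          ({πSt} : Finset (IrrClass (((UnitaryGroup.cmDatum L 2 (Matrix.of fun i j : Fin 2 => if i.val + j.val + 1 = 2 then (1 : L) else 0)).Local v × (UnitaryGroup.cmDatum L 1 (Matrix.of fun i j : Fin 1 => if i.val + j.val + 1 = 1 then (1 : L) else 0)).Local v)))) ∈ 𝔇.sqPacketsH →  -- hC07
          (∀ γ : Gqs L v, γ ∈ 𝔇.ellG ↔ IsRegularElt (γ.val : GL (Fin 3) (UnitaryGroup.LocalRing L v)) ∧ γ ∉ hyperbolicSet L v) →  -- hE
          (∀ π : IrrClass (Gqs L v), Measurable (𝔇.char π) ∧ LocallyIntegrable (𝔇.char π) 𝔇.μG ∧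
          (∀ x ∈ 𝔇.regG, ∀ᶠ y in 𝓝 x, 𝔇.char π y = 𝔇.char π x) ∧
          ∀ φ : Gqs L v → ℂ, IsLocSmooth φ → π.smoothTrace 𝔇.μG φ = ∫ x, φ x * 𝔇.char π x ∂𝔇.μG) →  -- hchar
          (∀ T : Subgroup (Gqs L v), T ∈ 𝔇.cartanAll ↔ T = (cmBorelTriple L 3 v).M ∨ T ∈ 𝔇.cartanG) →  -- hAll
          (𝔇.μT (cmBorelTriple L 3 v).M).IsHaarMeasure →  -- hHaar
          (∀ T ∈ 𝔇.cartanG, IsCompact (T : Set (Gqs L v)) ∧ ∃ γ₀ : Gqs L v, IsRegularElt (γ₀.val : GL (Fin 3) (UnitaryGroup.LocalRing L v)) ∧ T = Subgroup.centralizer ({γ₀} : Set (Gqs L v))) →  -- hcart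
          (∀ T ∈ 𝔇.cartanG, (𝔇.μT T).IsHaarMeasure) →  -- hHaarG
          (∀ T ∈ 𝔇.cartanG, IsFiniteMeasure (𝔇.μT T)) →  -- hfinG
          (∀ T ∈ 𝔇.cartanG, ∃ s : Finset (Subgroup ↥T), (∀ K ∈ s, IsClosed (K : Set ↥T) ∧ ¬ IsOpen (K : Set ↥T)) ∧ ∀ t : ↥T, ¬ IsRegularElt ((t : Gqs L v).val : GL (Fin 3) (UnitaryGroup.LocalRing L v)) → ∃ K ∈ s, t ∈ K) →  -- hker
          (∀ g : Gqs L v, 𝔇.DG g = ((NNReal.sqrt (NNReal.sqrt ((∏ w : PlacesOver L v, IsNonarchimedeanLocalField.normAbs (w.1.adicCompletion L) (((g.val : GL (Fin 3) (UnitaryGroup.LocalRing L v)).val.charpoly.discr) w)) * ((∏ w : PlacesOver L v, IsNonarchimedeanLocalField.normAbs (w.1.adicCompletion L) (((g.val : GL (Fin 3) (UnitaryGroup.LocalRing L v)).val.det) w)) ^ 2)⁻¹)) : NNReal) : ℝ)) →  -- eDG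
          (∀ s : ((UnitaryGroup.cmDatum L 2 (Matrix.of fun i j : Fin 2 => if i.val + j.val + 1 = 2 then (1 : L) else 0)).Local v × (UnitaryGroup.cmDatum L 1 (Matrix.of fun i j : Fin 1 => if i.val + j.val + 1 = 1 then (1 : L) else 0)).Local v), 𝔇.DH s = ((NNReal.sqrt (NNReal.sqrt ((∏ w : PlacesOver L v, IsNonarchimedeanLocalField.normAbs (w.1.adicCompletion L) (((s.1.val : GL (Fin 2) (UnitaryGroup.LocalRing L v)).val.charpoly.discr) w)) * (∏ w : PlacesOver L v, IsNonarchimedeanLocalField.normAbs (w.1.adicCompletion L) (((s.1.val : GL (Fin 2) (UnitaryGroup.LocalRing L v)).val.det) w))⁻¹)) : NNReal) : ℝ)) →  -- eDH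
          (∀ T ∈ 𝔇.cartanH, IsCompact (T : Set ((UnitaryGroup.cmDatum L 2 (Matrix.of fun i j : Fin 2 => if i.val + j.val + 1 = 2 then (1 : L) else 0)).Local v × (UnitaryGroup.cmDatum L 1 (Matrix.of fun i j : Fin 1 => if i.val + j.val + 1 = 1 then (1 : L) else 0)).Local v))) →  -- hKH
          (∀ T ∈ 𝔇.cartanH, IsFiniteMeasure (𝔇.μTH T)) →  -- hFH
          (∀ ρ ∈ 𝔇.sqPacketsH, ∀ T ∈ 𝔇.cartanH, ∀ C : Set ((UnitaryGroup.cmDatum L 2 (Matrix.of fun i j : Fin 2 => if i.val + j.val + 1 = 2 then (1 : L) else 0)).Local v × (UnitaryGroup.cmDatum L 1 (Matrix.of fun i j : Fin 1 => if i.val + j.val + 1 = 1 then (1 : L) else 0)).Local v), IsCompact C → C ⊆ (T : Set ((UnitaryGroup.cmDatum L 2 (Matrix.of fun i j : Fin 2 => if i.val + j.val + 1 = 2 then (1 : L) else 0)).Local v × (UnitaryGroup.cmDatum L 1 (Matrix.of fun i j : Fin 1 => if i.val + j.val + 1 = 1 then (1 : L) else 0)).Local v)) → ∃ B : ℝ,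 ∀ γ ∈ C, ‖(𝔇.DH γ : ℂ) * 𝔇.packetCharH ρ γ‖ ≤ B) →  -- hHBH
          (∀ π : IrrClass (Gqs L v), ¬ π.IsSquareIntegrable μZ → π.IsConstituentOf (UnitaryGroup.cmPrincipalSeries L 3 v (UnitaryGroup.cmTorusCharPair L v (par π).1 (par π).2)) ∧ Continuous (par π).1 ∧ Continuous (par π).2) →  -- hNL
          (∀ π : IrrClass (Gqs L v), (∃ (χ₁ : (UnitaryGroup.LocalRing L v)ˣ →* ℂˣ) (χ₂ : ↥(normOneUnits (conjLocal L (IsCMField.complexConj L) v)) →* ℂˣ), Continuous (fun x => ((χ₁ x : ℂˣ) : ℂ)) ∧ Continuous (fun x => ((χ₂ x : ℂˣ) : ℂ)) ∧ (UnitaryGroup.cmPrincipalSeries L 3 v (UnitaryGroup.cmTorusCharPair L v χ₁ χ₂)).IsIrreducible ∧ π.IsConstituentOf (UnitaryGroup.cmPrincipalSeries L 3 v (UnitaryGroup.cmTorusCharPair L v χ₁ χ₂))) → (UnitaryGroup.cmPrincipalSeries L 3 v (UnitaryGroup.cmTorusCharPair L v (par π).1 (par π).2)).IsIrreducible ∧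 π.IsConstituentOf (UnitaryGroup.cmPrincipalSeries L 3 v (UnitaryGroup.cmTorusCharPair L v (par π).1 (par π).2)) ∧ Continuous (par π).1 ∧ Continuous (par π).2 ∧ Continuous (fun x => (((par π).1 x : ℂˣ) : ℂ)) ∧ Continuous (fun x => (((par π).2 x : ℂˣ) : ℂ)) ∧ ∀ (ν : Measure (Gqs L v)) (f : Gqs L v → ℂ), π.smoothTrace ν f = Representation.smoothTrace (G := Gqs L v) (UnitaryGroup.cmPrincipalSeries L 3 v (UnitaryGroup.cmTorusCharPair L v (par π).1 (par π).2)) ν f) →  -- hPSpar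
          (∀ P : Finset (IrrClass (Gqs L v)), P ∈ 𝔇.ldsPackets ↔ (P.card = 2 ∧ ∃ (χ₁ : (UnitaryGroup.LocalRing L v)ˣ →* ℂˣ) (χ₂ : ↥(normOneUnits (conjLocal L (IsCMField.complexConj L) v)) →* ℂˣ), Continuous (fun x => ((χ₁ x : ℂˣ) : ℂ)) ∧ Continuous (fun x => ((χ₂ x : ℂˣ) : ℂ)) ∧ (∀ a : (UnitaryGroup.LocalRing L v)ˣ, (conjLocal L (IsCMField.complexConj L) v) (a : UnitaryGroup.LocalRing L v) = a → χ₁ a = 1) ∧ χ₁ ≠ 1 ∧ ∀ c : IrrClass (Gqs L v), c ∈ P ↔ c.IsConstituentOf (UnitaryGroup.cmPrincipalSeries L 3 v (UnitaryGroup.cmTorusCharPair L v χ₁ χ₂)))) →  -- hLdsF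
          (∀ (χ₁ : (UnitaryGroup.LocalRing L v)ˣ →* ℂˣ) (χ₂ : ↥(normOneUnits (conjLocal L (IsCMField.complexConj L) v)) →* ℂˣ), Continuous (fun x => ((χ₁ x : ℂˣ) : ℂ)) → Continuous (fun x => ((χ₂ x : ℂˣ) : ℂ)) → ∀ π π' : IrrClass (Gqs L v), ¬ π.IsSquareIntegrable μZ → ¬ π'.IsSquareIntegrable μZ → π.IsConstituentOf (UnitaryGroup.cmPrincipalSeries L 3 v (UnitaryGroup.cmTorusCharPair L v χ₁ χ₂)) → π'.IsConstituentOf (UnitaryGroup.cmPrincipalSeries L 3 v (UnitaryGroup.cmTorusCharPair L v χ₁ χ₂)) → par π = par π') →  -- hW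
          (∀ a b : ((UnitaryGroup.cmDatum L 2 (Matrix.of fun i j : Fin 2 => if i.val + j.val + 1 = 2 then (1 : L) else 0)).Local v × (UnitaryGroup.cmDatum L 1 (Matrix.of fun i j : Fin 1 => if i.val + j.val + 1 = 1 then (1 : L) else 0)).Local v), 𝔇.stConjH a b ↔ IsLocalStablyConjH L v a b) →  -- hStH
          (∀ a : ((UnitaryGroup.cmDatum L 2 (Matrix.of fun i j : Fin 2 => if i.val + j.val + 1 = 2 then (1 : L) else 0)).Local v × (UnitaryGroup.cmDatum L 1 (Matrix.of fun i j : Fin 1 => if i.val + j.val + 1 = 1 then (1 : L) else 0)).Local v), IsLocalGRegular L v a → a ∈ 𝔇.regH) →  -- hRegH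
          (∀ (α : ((UnitaryGroup.cmDatum L 2 (Matrix.of fun i j : Fin 2 => if i.val + j.val + 1 = 2 then (1 : L) else 0)).Local v × (UnitaryGroup.cmDatum L 1 (Matrix.of fun i j : Fin 1 => if i.val + j.val + 1 = 1 then (1 : L) else 0)).Local v) → ℂ) (x : Gqs L v), 𝔇.up α x = if IsRegularElt (x.val : GL (Fin 3) (UnitaryGroup.LocalRing L v)) then ((𝔇.DG x : ℂ))⁻¹ * ∑ᶠ q : Quot (IsLocalStablyConjH L v), (if IsLocalGRegular L v q.out ∧ IsLocalNormPair L (qsForm L) v q.out x then finTau L v q.out μ * (𝔇.DH q.out : ℂ) * ((finKappaAt L v (qsForm L) q.out x : ℤ) : ℂ) * α q.out else 0) else 0) →  -- hUp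
          (∀ ρ ∈ 𝔇.sqPacketsH, ∀ C : Set ((UnitaryGroup.cmDatum L 2 (Matrix.of fun i j : Fin 2 => if i.val + j.val + 1 = 2 then (1 : L) else 0)).Local v × (UnitaryGroup.cmDatum L 1 (Matrix.of fun i j : Fin 1 => if i.val + j.val + 1 = 1 then (1 : L) else 0)).Local v), IsCompact C → ∃ B : ℝ, ∀ s ∈ C, IsLocalGRegular L v s → ‖(𝔇.DH s : ℂ) * 𝔇.packetCharH ρ s‖ ≤ B) →  -- hHBHP
          (∀ ξ' : ((UnitaryGroup.cmDatum L 2 (Matrix.of fun i j : Fin 2 => if i.val + j.val + 1 = 2 then (1 : L) else 0)).Local v × (UnitaryGroup.cmDatum L 1 (Matrix.of fun i j : Fin 1 => if i.val + j.val + 1 = 1 then (1 : L) else 0)).Local v) →* ℂˣ, Continuous ξ' → ∃ (η₁ η₂ : ↥(normOneUnits (conjLocal L (IsCMField.complexConj L) v)) →* ℂˣ), Continuous (fun x => ((η₁ x : ℂˣ) : ℂ)) ∧ Continuous (fun x => ((η₂ x : ℂˣ) : ℂ)) ∧ KeysCaseTwoLabels L v (μ.semilocalComponent L v) η₁ η₂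 (𝔇.pi2 ξ') (𝔇.piN ξ')) →  -- hlabels
          (∀ ψ' : ↥(Subgroup.center (Gqs L v)) →* ℂˣ, Continuous ψ' → ∃ ψ : ↥(normOneUnits (conjLocal L (IsCMField.complexConj L) v)) →* ℂˣ, Continuous ψ ∧ 𝔇.stG ψ' ≠ 𝔇.detG ψ' ∧ ∀ c : IrrClass (Gqs L v), c.IsConstituentOf (UnitaryGroup.cmPrincipalSeries L 3 v (UnitaryGroup.cmTorusCharPair L v (halfModulusChar (UnitaryGroup.LocalRing L v) * halfModulusChar (UnitaryGroup.LocalRing L v))⁻¹ ψ)) ↔ (c = 𝔇.stG ψ' ∨ c = 𝔇.detG ψ')) →  -- hSt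
          (∀ ψ₀ : ↥(normOneUnits (conjLocal L (IsCMField.complexConj L) v)) →* ℂˣ, Continuous (fun x => ((ψ₀ x : ℂˣ) : ℂ)) → ∃ ψ : ↥(Subgroup.center (Gqs L v)) →* ℂˣ, Continuous ψ ∧ ∀ c : IrrClass (Gqs L v), c.IsConstituentOf (UnitaryGroup.cmPrincipalSeries L 3 v (UnitaryGroup.cmTorusCharPair L v (halfModulusChar (UnitaryGroup.LocalRing L v) * halfModulusChar (UnitaryGroup.LocalRing L v))⁻¹ ψ₀)) ↔ (c = 𝔇.stG ψ ∨ c = 𝔇.detG ψ)) →  -- hStJH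
          (∀ (η₁ η₂ : ↥(normOneUnits (conjLocal L (IsCMField.complexConj L) v)) →* ℂˣ), Continuous (fun x => ((η₁ x : ℂˣ) : ℂ)) → Continuous (fun x => ((η₂ x : ℂˣ) : ℂ)) → ∃ ξ' : ((UnitaryGroup.cmDatum L 2 (Matrix.of fun i j : Fin 2 => if i.val + j.val + 1 = 2 then (1 : L) else 0)).Local v × (UnitaryGroup.cmDatum L 1 (Matrix.of fun i j : Fin 1 => if i.val + j.val + 1 = 1 then (1 : L) else 0)).Local v) →* ℂˣ, Continuous ξ' ∧ KeysCaseTwoLabels L v (μ.semilocalComponent L v) η₁ η₂ (𝔇.pi2 ξ') (𝔇.piN ξ')) →  -- hKeysJH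
          (∀ ρ ∈ 𝔇.sqPacketsH, ∀ a : ((UnitaryGroup.cmDatum L 2 (Matrix.of fun i j : Fin 2 => if i.val + j.val + 1 = 2 then (1 : L) else 0)).Local v × (UnitaryGroup.cmDatum L 1 (Matrix.of fun i j : Fin 1 => if i.val + j.val + 1 = 1 then (1 : L) else 0)).Local v), IsLocalGRegular L v a → ∀ᶠ a' in 𝓝 a, 𝔇.packetCharH ρ a' = 𝔇.packetCharH ρ a) →  -- hM1lc
          (∀ γ : Gqs L v, IsRegularElt (γ.val : GL (Fin 3) (UnitaryGroup.LocalRing L v)) → ∃ T' ∈ 𝔇.cartanAll, ∃ x : Gqs L v, ∀ g : Gqs L v, g ∈ Subgroup.centralizer ({γ} : Set (Gqs L v)) ↔ x⁻¹ * g * x ∈ T') →  -- hcovA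
          (∀ T' ∈ 𝔇.cartanAll, ∀ T'' ∈ 𝔇.cartanAll, T' ≠ T'' → ∀ y : Gqs L v, ¬ ∀ h : Gqs L v, h ∈ T'' ↔ y⁻¹ * h * y ∈ T') →  -- hncA
          (∀ T' ∈ 𝔇.cartanAll, T' ≠ (cmBorelTriple L 3 v).M → IsCompact (T' : Set (Gqs L v))) →  -- hcptA
          (∀ T' ∈ 𝔇.cartanAll, (𝔇.μT T').IsInvInvariant) →  -- hinvT
          (∀ T' ∈ 𝔇.cartanAll, 𝔇.μT T' (compactCore ↥T') = 1) →  -- hcoreT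
          (∀ π ∈ 𝔇.irredPS, ∃ (χ₁ : (UnitaryGroup.LocalRing L v)ˣ →* ℂˣ) (χ₂ : ↥(normOneUnits (conjLocal L (IsCMField.complexConj L) v)) →* ℂˣ), Continuous (fun x => ((χ₁ x : ℂˣ) : ℂ)) ∧ Continuous (fun x => ((χ₂ x : ℂˣ) : ℂ)) ∧ (UnitaryGroup.cmPrincipalSeries L 3 v (UnitaryGroup.cmTorusCharPair L v χ₁ χ₂)).IsIrreducible ∧ π.IsConstituentOf (UnitaryGroup.cmPrincipalSeries L 3 v (UnitaryGroup.cmTorusCharPair L v χ₁ χ₂))) →  -- hIrr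
          (∀ ξ' : ((UnitaryGroup.cmDatum L 2 (Matrix.of fun i j : Fin 2 => if i.val + j.val + 1 = 2 then (1 : L) else 0)).Local v × (UnitaryGroup.cmDatum L 1 (Matrix.of fun i j : Fin 1 => if i.val + j.val + 1 = 1 then (1 : L) else 0)).Local v) →* ℂˣ, (𝔇.pi2 ξ').IsSquareIntegrable 𝔇.μGZ ∧ ¬ (𝔇.piN ξ').IsSquareIntegrable 𝔇.μGZ) →  -- hKeys
          𝔇.DetNotL2 →  -- hDet
          𝔇.PacketCharHRegularity →  -- hM1H
          (∀ ψ' : ↥(Subgroup.center (Gqs L v)) →* ℂˣ, Continuous ψ' → 𝔇.IsL2 (𝔇.stG ψ')) →  -- hStL2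
          𝔇.cartanG = Sell →  -- eCartanG
          (∀ T' : Subgroup (Gqs L v), 𝔇.μT T' = μTf T') →  -- eMuT
          𝔇.cartanH = SH →  -- eCartanH
          (∀ T' : Subgroup ((UnitaryGroup.cmDatum L 2 (Matrix.of fun i j : Fin 2 => if i.val + j.val + 1 = 2 then (1 : L) else 0)).Local v × (UnitaryGroup.cmDatum L 1 (Matrix.of fun i j : Fin 1 => if i.val + j.val + 1 = 1 then (1 : L) else 0)).Local v), 𝔇.μTH T' = μTHf T') →  -- eMuTH
          (∀ a : ((UnitaryGroup.cmDatum L 2 (Matrix.of fun i j : Fin 2 => if i.val + j.val + 1 = 2 then (1 : L) else 0)).Local v × (UnitaryGroup.cmDatum L 1 (Matrix.of fun i j : Fin 1 => if i.val + j.val + 1 = 1 then (1 : L) else 0)).Local v), a ∈ 𝔇.regH ↔ IsLocalGRegular L v a) →  -- eRegH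
          (∀ a : ((UnitaryGroup.cmDatum L 2 (Matrix.of fun i j : Fin 2 => if i.val + j.val + 1 = 2 then (1 : L) else 0)).Local v × (UnitaryGroup.cmDatum L 1 (Matrix.of fun i j : Fin 1 => if i.val + j.val + 1 = 1 then (1 : L) else 0)).Local v), a ∈ 𝔇.ellH ↔ IsLocalGRegular L v a ∧ IsCompact ((Subgroup.centralizer ({a} : Set ((UnitaryGroup.cmDatum L 2 (Matrix.of fun i j : Fin 2 => if i.val + j.val + 1 = 2 then (1 : L) else 0)).Local v × (UnitaryGroup.cmDatum L 1 (Matrix.of fun i j : Fin 1 => if i.val + j.val + 1 = 1 then (1 : L) else 0)).Local v)) : Subgroup ((UnitaryGroup.cmDatum L 2 (Matrix.of fun i j : Fin 2 => if i.val + j.val + 1 = 2 then (1 : L) else 0)).Local v × (UnitaryGroup.cmDatum L 1 (Matrix.of fun i j : Fin 1 => if i.val + j.val + 1 = 1 then (1 : L) else 0)).Local v)) : Set ((UnitaryGroup.cmDatum L 2 (Matrix.of fun i j : Fin 2 => if i.val + j.val + 1 = 2 then (1 : L) else 0)).Local v × (UnitaryGroup.cmDatum L 1 (Matrix.of fun i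 j : Fin 1 => if i.val + j.val + 1 = 1 then (1 : L) else 0)).Local v))) →  -- eEllH
          𝔇.sqPacketsH = {({πSt} : Finset (IrrClass ((UnitaryGroup.cmDatum L 2 (Matrix.of fun i j : Fin 2 => if i.val + j.val + 1 = 2 then (1 : L) else 0)).Local v × (UnitaryGroup.cmDatum L 1 (Matrix.of fun i j : Fin 1 => if i.val + j.val + 1 = 1 then (1 : L) else 0)).Local v)))} →  -- eSq
          (∀ π : IrrClass (Gqs L v), (∃ (χ₁ : (UnitaryGroup.LocalRing L v)ˣ →* ℂˣ) (χ₂ : ↥(normOneUnits (conjLocal L (IsCMField.complexConj L) v)) →* ℂˣ), Continuous (fun x => ((χ₁ x : ℂˣ) : ℂ)) ∧ Continuous (fun x => ((χ₂ x : ℂˣ) : ℂ)) ∧ (UnitaryGroup.cmPrincipalSeries L 3 v (UnitaryGroup.cmTorusCharPair L v χ₁ χ₂)).IsIrreducible ∧ π.IsConstituentOf (UnitaryGroup.cmPrincipalSeries L 3 v (UnitaryGroup.cmTorusCharPair L v χ₁ χ₂))) → π ∈ 𝔇.irredPS) →  -- eIrr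
          (∀ (η₁ η₂ : ↥(normOneUnits (conjLocal L (IsCMField.complexConj L) v)) →* ℂˣ), Continuous (fun x => ((η₁ x : ℂˣ) : ℂ)) → Continuous (fun x => ((η₂ x : ℂˣ) : ℂ)) → ∀ ξ' : ((UnitaryGroup.cmDatum L 2 (Matrix.of fun i j : Fin 2 => if i.val + j.val + 1 = 2 then (1 : L) else 0)).Local v × (UnitaryGroup.cmDatum L 1 (Matrix.of fun i j : Fin 1 => if i.val + j.val + 1 = 1 then (1 : L) else 0)).Local v) →* ℂˣ, (∀ hh : ((UnitaryGroup.cmDatum L 2 (Matrix.of fun i j : Fin 2 => if i.val + j.val + 1 = 2 then (1 : L) else 0)).Local v × (UnitaryGroup.cmDatum L 1 (Matrix.of fun i j : Fin 1 => if i.val + j.val + 1 = 1 then (1 : L) else 0)).Local v), ξ' hh = η₁ (localDet (IsCMField.complexConj L) v (isUnit_antidiagOne_det L 2) hh.1) * η₂ (localDet (IsCMField.complexConj L) v (isUnit_antidiagOne_det L 2) hh.1 * localDet (IsCMField.complexConj L) v (isUnit_antidiagOne_det L 1) hh.2)) → KeysCaseTwoLabels L v (μ.semilocalComponent L v) η₁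 η₂ (𝔇.pi2 ξ') (𝔇.piN ξ')) →  -- eLab
          (∀ ρ : IrrClass ((UnitaryGroup.cmDatum L 2 (Matrix.of fun i j : Fin 2 => if i.val + j.val + 1 = 2 then (1 : L) else 0)).Local v × (UnitaryGroup.cmDatum L 1 (Matrix.of fun i j : Fin 1 => if i.val + j.val + 1 = 1 then (1 : L) else 0)).Local v), 𝔇.charH ρ = 𝔇.charH πSt) →  -- eCharH
          (∃ (ιZ : ↥(normOneUnits (conjLocal L (IsCMField.complexConj L) v)) →* ↥(Subgroup.center (Gqs L v))) (detZ : (Gqs L v) →* ↥(Subgroup.center (Gqs L v))), Continuous ιZ ∧ Continuous detZ ∧ (∀ z : ↥(normOneUnits (conjLocal L (IsCMField.complexConj L) v)), ((ιZ z).val.val.val : Matrix (Fin 3) (Fin 3) (UnitaryGroup.LocalRing L v)) = (((z : (UnitaryGroup.LocalRing L v)ˣ) : UnitaryGroup.LocalRing L v)) • (1 : Matrix (Fin 3) (Fin 3) (UnitaryGroup.LocalRing L v))) ∧ (∀ g : (Gqs L v), ((detZ g).val.val.val : Matrix (Fin 3) (Fin 3) (UnitaryGroup.LocalRing L v)) =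 (g.val.val : Matrix (Fin 3) (Fin 3) (UnitaryGroup.LocalRing L v)).det • (1 : Matrix (Fin 3) (Fin 3) (UnitaryGroup.LocalRing L v))) ∧ ∀ ψ : ↥(Subgroup.center (Gqs L v)) →* ℂˣ, Continuous ψ → (∃ hopen : IsOpen (((ψ.comp detZ).ker : Subgroup (Gqs L v)) : Set (Gqs L v)), 𝔇.detG ψ = IrrClass.mk (SmoothIrrep.ofChar (ψ.comp detZ) hopen)) ∧ 𝔇.stG ψ ≠ 𝔇.detG ψ ∧ (∀ c : IrrClass (Gqs L v), c.IsConstituentOf (cmPrincipalSeries L 3 v (cmTorusCharPair L v (halfModulusChar (UnitaryGroup.LocalRing L v) * halfModulusChar (UnitaryGroup.LocalRing L v))⁻¹ (ψ.comp ιZ))) ↔ (c = 𝔇.stG ψ ∨ c = 𝔇.detG ψ)) ∧ (𝔇.stG ψ).IsSquareIntegrable μZ ∧ ¬ (𝔇.detG ψ).IsSquareIntegrable μZ) →  -- eSt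
      ∀ π π' : IrrClass (Gqs L v), 𝔇.IsEllipticRep π → 𝔇.IsEllipticRep π' →
        𝔇.innerG (𝔇.char π) (𝔇.char π') ≠ 0 → π ≠ π' → 𝔇.IsEllipticPair π π' := by
  intro L _ _ _ μ ξ v hns hμu hμω _ _ _ _ νHv νQv _ _ _ _ mHv mQv hcanH hcanQ hT_v π₁ πSt hlab hπ₁ _ _ μZ _ Sell μTf SH μTHf hcartO hcovGO hncGO hHaarGO hcoreGO
    hHaarMO hcoreMO hKHO hcovHO hncHO hHaarHO hprobHO 𝔇 par hC01 hC02 hC03 hC04 hC05 hC06 hC07 hE hchar hAll hHaar hcart hHaarG hfinG hker eDG eDH hKH hFH hHBH hNL hPSpar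
    hLdsF hW hStH hRegH hUp hHBHP hlabels hSt hStJH hKeysJH hM1lc hcovA hncA hcptA hinvT hcoreT hIrr hKeys hDet hM1H hStL2 eCartanG eMuT eCartanH eMuTH eRegH eEllH eSq
    eIrr eLab eCharH eSt π π' hπ hπ' hne0 hne
  have hKeysRedv := hKeysRed L v hns
  letI : ∀ γ : Gqs L v, MeasurableSpace (Gqs L v ⧸ Subgroup.centralizer ({γ} : Set (Gqs L v))) := fun _ => borel _
  haveI : ∀ γ : Gqs L v, BorelSpace (Gqs L v ⧸ Subgroup.centralizer ({γ} : Set (Gqs L v))) := fun _ => ⟨rfl⟩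
  -- (1) ★ DG-FIELD; (2) ★ WIF-AT-THE-DATUM from the Cartan pins; (3) ★ CARTAN-FIELDS∕NULL + ★ L2D-ELL∕L2D-OF-HCB; (4) ★ hLdsTwo chain + ★ RED-JH; then the case split
  have hDGm : Measurable 𝔇.DG := F0P3cStCharTSDGField.measurable_DG L v 𝔇 eDG
  have hDG := F0P3cStCharTSDGField.DG_eq_zero_or_le L v 𝔇 eDG
  have hShapeA : ∀ T' ∈ 𝔇.cartanAll, ∃ γ₀ : Gqs L v, IsRegularElt (γ₀.val : GL (Fin 3) (UnitaryGroup.LocalRing L v)) ∧ T' = Subgroup.centralizer ({γ₀} : Set (Gqs L v)) :=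
    fun T' hT' => by
      rcases (hAll T').1 hT' with h | h
      · subst h; obtain ⟨m₀, -, hreg, hZ⟩ := F0P3cStCharTSCartanReps.exists_isRegularElt_centralizer_eq_cmTorus L v hns; exact ⟨m₀, hreg, hZ.symm⟩
      · exact (hcart T' h).2
  have hHaarT : ∀ T' ∈ 𝔇.cartanAll, (𝔇.μT T').IsHaarMeasure := fun T' hT' => by
    rcases (hAll T').1 hT' with h | h
    · subst h; exact hHaar
    · exact hHaarG T' h
  have hWIF : 𝔇.WeylIntegrationFormula :=
    F0P3cStCharTSWeylDatumPinsWIF.weylIntegrationFormula_of_datumPins L v hns νQv mQv 𝔇 hC01 hC04 hcanQ hC05 hShapeA hcovA hncA hcptA hHaarT hinvT hcoreT eDG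
      (F0P3cStCharTSJacCartanTerminus.tubeJacobianSocket_compactCartan L v hns νQv)
  have hC2cert : 𝔇.EllCartanAE :=
    F0P3cStCharTSCartanFields.ellCartanAE_of_compact_centralizers L v 𝔇 hE hcart
      (F0P3cStCharTSCartanNull.cartanNull_of_rootKernels L v 𝔇 hHaarG (fun T hT => (hcart T hT).1) hker)
  have hC1cert : 𝔇.EllCartanSubset := fun T hT => (hAll T).2 (Or.inr hT)
  have hC3cert : 𝔇.NonEllCartanAE :=
    F0P3cStCharTSCartanFields.nonEllCartanAE_of_split L v 𝔇 hC05 hE (fun T hT hTn => ((hAll T).1 hT).resolve_right hTn) hHaar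
  have hL2allcert : 𝔇.L2CharOnTorusAll :=
    F0P3cStCharTSL2dEll.l2CharOnTorusAll_of_elliptic 𝔇 hC2cert
      (F0P3cStCharTSL2dOfHcb.l2dEll_of_hcBounded L v hHCB νQv 𝔇 hC01 hC05 hchar hDGm (fun T hT => (hcart T hT).1) hfinG hDG)
  have hLdsTwo := F0P3cStCharTSLdsTwoOfTwo.ldsTwo_of_ldsReducibleTwo L v hns
    (F0P3cStCharTSLdsRedTwoOfReducible.ldsRedTwo_of_keysRedThree L v hns (F0P3cStCharTSKeys3AnalyticHalf.hKeysRed3_holds L v hns))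
  have hRedJH := F0P3cStCharTSRedJH.redJH_of_keysRed L v hns 𝔇 (μ.semilocalComponent L v)
    (isQuadraticCharExtension_semilocalComponent_of_baseChange_eq μ hμω v) (Units.continuous_val.comp (UnitaryGroup.continuous_semilocalComponent L μ))
    hKeysRedv hStJH hKeysJH hLdsF hLdsTwo
  have hVan := F0P3cStCharTSPsVanish.char_eq_zero_on_ellG_of_isConstituentOf_irreducible L v hns νQv mQv hcanQ 𝔇 hC01 hC05 (fun γ hγ => (hE γ).1 hγ) hchar
  have hLds2 := (F0P3cStCharTSLdsFields.lds_sockets_of_ldsFields hns μZ 𝔇 hC03 hLdsF).2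
  by_cases hsc' : π'.IsSupercuspidal
  · exact absurd (F0P3cStCharTSScPseudoCoeff.innerG_char_eq_zero_of_ne_of_isSupercuspidal L v hns νQv mQv hcanQ 𝔇 hC01 hC04 hC05 hE hchar hWIF hC1cert hC2cert hC3cert
      hL2allcert π π' hsc' hne) hne0
  · by_cases hsc : π.IsSupercuspidal
    · have h0 := F0P3cStCharTSScPseudoCoeff.innerG_char_eq_zero_of_ne_of_isSupercuspidal L v hns νQv mQv hcanQ 𝔇 hC01 hC04 hC05 hE hchar hWIF hC1cert hC2cert hC3cert
        hL2allcert π' π hsc (Ne.symm hne)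
      have h0' : 𝔇.innerG (𝔇.char π) (𝔇.char π') = 0 := by
        rw [F0P3cStCharTSScFin.innerG_conj_symm 𝔇 (𝔇.char π') (𝔇.char π), h0, map_zero]
      exact absurd h0' hne0
    · by_cases hunr : (Algebra.IsUnramifiedIn (𝓞 L) v.asIdeal ∨ Valued.v (2 : v.adicCompletion ↥(maximalRealSubfield L)) = 1)
      · exact isEllipticPair_of_innerG_ne_zero_of_cross L v hns 𝔇
          (fun r r' hsplit₂ hHom0 => F0P3cStCharTSEPCrossNormZeroNotWild.innerG_char_cross_eq_zero_of_not_wild L v hns hunr νQv mQv hcanQ 𝔇 hC01 hC04 hC05 hE hchar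
            hWIF hC1cert hC2cert hC3cert hL2allcert r r' hsplit₂ hHom0)
          hVan hLds2 hRedJH π π' hπ hπ' hsc hsc' hne0 hne
      · exact isEllipticPair_of_innerG_ne_zero_of_cross L v hns 𝔇
          (fun r r' hsplit₂ hHom0 => hCrossW L v hns hunr νQv mQv hcanQ 𝔇 hC01 hC04 hC05 hE hchar hWIF hC1cert hC2cert hC3cert hL2allcert r r' hsplit₂ hHom0)
          hVan hLds2 hRedJH π π' hπ hπ' hsc hsc' hne0 hne

end Summit.HodgeConjecture.HodgeConjecture.Cruxes.H413.K2E3EllipticInnerNonzeroIsPairOfCrossWild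

end
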